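/-
Literature file (hubbard-downfold router, multi-orbital branch `UND:MULTIORB(k = 5)` for the Fe pnictides /
chalcogenides): the exact geometry of the `MX₄` tetrahedron of the layered iron-based superconductors —
twofold and fourfold `X–M–X` bond angles and the «pnictogen height» as functions of the tetragonal cell data
`(a, c, z)` — as printed by Johnston (2010, §2.1, Eqs. (Eqtheta)) and used throughout the
«`T_c` versus bond angle / anion height» literature (Lee et al. 2008; Kimber et al. 2009).
-/
import Mathlib
import HarnessLib

/-!
# The `MX₄` tetrahedron of the iron pnictides: bond angles, pnictogen height, regularity

In every structural family of the Fe-based superconductors (11, 111, 122, 1111) the transition-metal atoms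
`M` form a square lattice of spacing `a/√2` and each `M` is tetrahedrally coordinated by four pnictogen /
chalcogen atoms `X`, two in the plane a height `h` above the `M` layer and two a height `h` below it.
Johnston [Johnston2010, §2.1 Eqs. (Eqtheta), citing Nath et al. 2009] prints, for tetragonal cell
parameters `a, c` and the `c`-axis position parameter `z` of `X`,

* `θ₂ = arccos[(−a²/4 + (z − α)²c²)/r²]` — the TWOFOLD `X–M–X` angle (both `X` on the same side),
* `θ₄ = arccos[−(z − α)²c²/r²]` — the FOURFOLD `X–M–X` angle (the two `X` on opposite sides),
* `r² = a²/4 + (z − α)²c²` — the `M–X` bond length, the same for all four bonds,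
* `h = |z − α| c` — the height of an `X` plane above/below the `M` plane, with `α = 0, 1/4, 1/2, 1` for the
  11-, 122-, 1111-, 111-type cells, and `d_{M–M} = a/√2`,

and states: «The average bond angle for all six X-M-X bonds is close to the value of 109.47° for an
undistorted tetrahedron. Thus if `θ₂ > 109.47°` then `θ₄ < 109.47°`, and vice versa.» The structure–`T_c`
correlations of Lee et al. [LeeEtAl2008] (maximal `T_c` where the `FeAs₄` tetrahedron is regular,
`θ₂ = 109.47°`) and of Kimber et al. [KimberEtAl2009] (under pressure, `T_c,max` of `BaFe₂As₂` where the
tetrahedron becomes regular) are phrased in these variables.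

This file types the dictionary EXACTLY, with the `X` positions relative to `M` taken as
`(±a/2, 0, h)` (upper pair) and `(0, ±a/2, −h)` (lower pair):

* `height`, `bondLength`, `cosTwofold`, `cosFourfold`, `twofoldAngle`, `fourfoldAngle`, `metalDistance`,
  `tetrahedralAngle = arccos(−1/3)`;
* the printed formulas ARE the cosine rule on those coordinates (`cosTwofold_eq_dot`, `cosFourfold_eq_dot`,
  `bondLength_sq`, `metalDistance_sq`);
* the exact linear relation `cos θ₂ + 2 cos θ₄ = −1` (`cosTwofold_add_two_mul_cosFourfold`) — the precise
  content of Johnston's «average close to 109.47° … if `θ₂ > 109.47°` then `θ₄ < 109.47°` and vice versa»,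
  which is proved as `tetrahedralAngle_lt_twofoldAngle_iff`;
* regularity: `cos θ₂ = −1/3 ⇔ cos θ₄ = −1/3 ⇔ cos θ₂ = cos θ₄ ⇔ h² = a²/8` (i.e. `h = a/(2√2)`), and the
  angle form `θ₂ = arccos(−1/3) ⇔ h² = a²/8`;
* monotonicity: at fixed `a ≠ 0` the twofold angle is strictly DEcreasing and the fourfold angle strictly
  INcreasing in the height `h ≥ 0` (a taller pnictogen closes the twofold angle);
* inversion `h² = (a²/4)(1 + cos θ₂)/(1 − cos θ₂)`;
* decidable numeric corollaries for the cells quoted in the hubbard-downfold literature tables (Johnston's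
  Appendix rows): `BaFe₂As₂` (`a = 3.9625`, `h = 1.360` Å) and `NdFeAsO₀.₈₃` at 10 K (`3.9423`, `1.382`) have
  `h² < a²/8` hence `θ₂ > arccos(−1/3)`; `Fe₁₊yTe` (`3.8219`, `1.755`) and `CsFe₂As₂` (`3.902`, `1.3868`) have
  `h² > a²/8` hence `θ₂ < arccos(−1/3)` — matching the printed `111.1°`, `109.91°`, `94.88°` and (derived)
  `109.2°`.

* §8 (appended 2026-08-27): the ASYMMETRIC tetrahedron of the ordered 1144 structures (`P4/mmm`, two
  inequivalent pnictogen sites: height `h₁` above, `h₂` below the metal plane; `S₄ → C₂` at `M`) — `cosMixed a h₁ h₂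
  = −h₁h₂/(r₁r₂)` for the four mixed As1–M–As2 angles (cosine rule on `(0, a/2, h₁)`, `(a/2, 0, −h₂)`; `= cosFourfold`
  when `h₁ = h₂`; range `(−1, 0]`), the exact ASYMMETRIC SUM RULE `cos θ₂(h₁) + cos θ₂(h₂) + 4 cos θ_m =
  −2 + 2(h₁/r₁ − h₂/r₂)² ≥ −2` with equality iff `h₁ = h₂` (Johnston's `cos θ₂ + 2 cos θ₄ = −1`), the reference
  angles `cos(5π/8) = −√(2−√2)/2` (112.5°) and `cos(3π/5) = −(√5−1)/4` (108°) with certified decimals, and decidable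
  witnesses for `RbEuFe₄As₄` (Liu et al. 2016 TABLE I: `h₁ = 1.2489`, `h₂ = 1.4699 Å`; `θ₂(As1) > 5π/8` and
  `> arccos(−1/3)`, `θ₂(As2) < 3π/5 < arccos(−1/3)`, mixed angle in `(3π/5, arccos(−1/3))` — so of the printed pair
  «112.50° / 109.04°» the second is the MIXED angle and the first is not a TABLE-I angle) and `CaKFe₄As₄` (Mou et al.
  2016 TABLE I: both twofold angles `< arccos(−1/3) <` mixed angle — the opposite placement).
* §9 (appended 2026-08-27): the same twofold-pair geometry in the `R–O₈` cage of `RBa₂Cu₃O₇`: Mazin's Fehrenbacher–Rice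
  band factor `cos 2φ = ((a/2)² − v²)/((a/2)² + v²) = −cos θ₂` (`frFactor`; `= cos(2 arctan(2v/a))`), `0` for FR's 45° cage,
  `1/3` exactly at Mazin's ideal `tan φ = 1/√2` — which IS the regular-tetrahedron condition `v² = a²/8` of §1 — and the
  refined `PrBa₂Cu₃O₇` cage (López-Morales et al. 1990, COD 1534701) as witness: `tan²φ > 1/2` on both bonds and
  `0.25 < cos 2φ(O3) < 0.26`, `0.27 < cos 2φ(O4) < 0.28` — below the ideal `1/3`.

WHAT THIS IS NOT: any statement that `T_c` correlates with `θ₂` or `h` (those are empirical envelopes,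
[Johnston2010, §2.2–2.3], not theorems), nor a structure refinement: `(a, c, z)` are inputs. No named facts;
everything here is elementary real algebra plus `Real.arccos` monotonicity from Mathlib.

## References

* D. C. Johnston, *The puzzle of high temperature superconductivity in layered iron pnictides and
  chalcogenides*, Adv. Phys. 59 (2010) 803–1061, §2.1 Eqs. (Eqtheta) and Appendix Tables (crystal data).
  [Johnston2010]
* C.-H. Lee et al., J. Phys. Soc. Jpn. 77 (2008) 083704 (regular `FeAs₄` tetrahedron ↔ maximal `T_c`).
  [LeeEtAl2008]
* S. A. J. Kimber et al., Nature Mater. 8 (2009) 471–475 (`BaFe₂As₂` under pressure: `T_c,max` at the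
  regular tetrahedron). [KimberEtAl2009]
* Yi Liu et al., *Superconductivity and ferromagnetism in hole-doped RbEuFe₄As₄*, Phys. Rev. B 93 (2016) 214503,
  arXiv:1605.04396 — TABLE I (P4/mmm cell and coordinates) and p. 3 («asymmetric» Fe coordination; heights 1.249 /
  1.467 Å; «bond angles As1−Fe−As1 and As2−Fe−As2 are 112.50° and 109.04°»). [LiuEtAl2016RbEuFe4As4]
* D. Mou et al., *Enhancement of the superconducting gap by nesting in CaKFe₄As₄: a new high temperature
  superconductor*, Phys. Rev. Lett. 117 (2016) 277001, arXiv:1606.05643 — TABLE I (single-crystal cell and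
  coordinates of CaKFe₄As₄). [MouEtAl2016CaKFe4As4]
* I. I. Mazin, *On the possibility of superconductivity in PrBa₂Cu₃O₇*, Phys. Rev. B 60 (1999) 92, arXiv:cond-mat/9806246,
  p. 3–4 (the Pr–O bond angle «not 45° but tan⁻¹(1/√2)»; the FR band `ε_k − E_p = δε − δε cos 2φ (cos ak_x + cos bk_y)/2`,
  `W = δε cos 2φ = δε/3`). [Mazin1999PrBa2Cu3O7FRband]
* M. E. López-Morales et al., Phys. Rev. B 41 (1990) 6655 — refined Pmmm structure of PrBa₂Cu₃O₇ (COD entry 1534701: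
  a 3.8654, b 3.9309, c 11.725 Å; z(O3) 0.3726, z(O4) 0.3739, Pr at z = 1/2). [LopezMoralesEtAl1990PrBa2Cu3O7]
-/

noncomputable section

namespace Literature.MathematicalPhysics.QuantumManyBody

namespace MX4

/-! ## The printed dictionary -/

/-- Height of a pnictogen/chalcogen plane above (or below) the metal plane, `h = |z − α| c`, with `α = 0`
(11-type), `1/4` (122), `1/2` (1111), `1` (111). [cite: Johnston2010, §2.1 Eqs. (Eqtheta)] -/
def height (z α c : ℝ) : ℝ := |z - α| * c

/-- The `M–X` bond length `r = √(a²/4 + h²)` (all four bonds of the tetrahedron are equal).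
[cite: Johnston2010, §2.1 Eqs. (Eqtheta)] -/
def bondLength (a h : ℝ) : ℝ := Real.sqrt (a ^ 2 / 4 + h ^ 2)

/-- Cosine of the TWOFOLD `X–M–X` angle (two `X` on the same side of the `M` plane):
`cos θ₂ = (−a²/4 + h²)/(a²/4 + h²)`. [cite: Johnston2010, §2.1 Eqs. (Eqtheta)] -/
def cosTwofold (a h : ℝ) : ℝ := (-(a ^ 2 / 4) + h ^ 2) / (a ^ 2 / 4 + h ^ 2)

/-- Cosine of the FOURFOLD `X–M–X` angle (the two `X` on opposite sides of the `M` plane):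
`cos θ₄ = −h²/(a²/4 + h²)`. [cite: Johnston2010, §2.1 Eqs. (Eqtheta)] -/
def cosFourfold (a h : ℝ) : ℝ := -(h ^ 2) / (a ^ 2 / 4 + h ^ 2)

/-- The twofold `X–M–X` bond angle `θ₂ = arccos(cos θ₂)` (radians). [cite: Johnston2010, §2.1 Eqs. (Eqtheta)] -/
def twofoldAngle (a h : ℝ) : ℝ := Real.arccos (cosTwofold a h)

/-- The fourfold `X–M–X` bond angle `θ₄ = arccos(cos θ₄)` (radians). [cite: Johnston2010, §2.1 Eqs. (Eqtheta)] -/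
def fourfoldAngle (a h : ℝ) : ℝ := Real.arccos (cosFourfold a h)

/-- Nearest-neighbour metal–metal distance of the square `M` lattice, `d_{M–M} = a/√2`.
[cite: Johnston2010, §2.1 (text after Eqs. (Eqtheta))] -/
def metalDistance (a : ℝ) : ℝ := a / Real.sqrt 2

/-- The bond angle of a regular (undistorted) tetrahedron, `arccos(−1/3) ≈ 109.47°`.
[cite: Johnston2010, §2.1 and caption of Fig. (TcAngle) («arccos(−1/3) ≈ 109.47°»)] -/
def tetrahedralAngle : ℝ := Real.arccos (-1 / 3)

/-! ## The formulas are the cosine rule on the tetrahedron's coordinates -/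

/-- `a²/4 + h² > 0` as soon as `a ≠ 0`. [folklore] -/
private lemma denom_pos {a : ℝ} (h : ℝ) (ha : a ≠ 0) : 0 < a ^ 2 / 4 + h ^ 2 := by
  have : 0 < a ^ 2 := by positivity
  positivity

/-- `r² = a²/4 + h²`: the squared bond length is the squared norm of the position `(a/2, 0, h)` of an upper
`X` atom relative to `M` (and of `(0, a/2, −h)` for a lower one). [cite: Johnston2010, §2.1 Eqs. (Eqtheta)] -/
theorem bondLength_sq (a h : ℝ) :
    bondLength a h ^ 2 = (a / 2) ^ 2 + 0 ^ 2 + h ^ 2 ∧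
      bondLength a h ^ 2 = 0 ^ 2 + (a / 2) ^ 2 + (-h) ^ 2 := by
  have h0 : 0 ≤ a ^ 2 / 4 + h ^ 2 := by positivity
  unfold bondLength
  rw [Real.sq_sqrt h0]
  constructor <;> ring

/-- The printed `cos θ₂` is the cosine rule `⟪X₁, X₂⟫/(|X₁| |X₂|)` for the upper pair `X₁ = (a/2, 0, h)`,
`X₂ = (−a/2, 0, h)`. [cite: Johnston2010, §2.1 Eqs. (Eqtheta)] -/
theorem cosTwofold_eq_dot (a h : ℝ) :
    cosTwofold a h =
      ((a / 2) * (-(a / 2)) + 0 * 0 + h * h) / (bondLength a h * bondLength a h) := by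
  have h0 : 0 ≤ a ^ 2 / 4 + h ^ 2 := by positivity
  unfold cosTwofold bondLength
  rw [Real.mul_self_sqrt h0]
  ring

/-- The printed `cos θ₄` is the cosine rule for an upper/lower pair `X₁ = (a/2, 0, h)`, `X₃ = (0, a/2, −h)`.
[cite: Johnston2010, §2.1 Eqs. (Eqtheta)] -/
theorem cosFourfold_eq_dot (a h : ℝ) :
    cosFourfold a h =
      ((a / 2) * 0 + 0 * (a / 2) + h * (-h)) / (bondLength a h * bondLength a h) := by
  have h0 : 0 ≤ a ^ 2 / 4 + h ^ 2 := by positivity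
  unfold cosFourfold bondLength
  rw [Real.mul_self_sqrt h0]
  ring

/-- `d_{M–M}² = (a/2)² + (a/2)²`: the nearest `M` neighbour sits at `(a/2, a/2, 0)`, so `d_{M–M} = a/√2`.
[cite: Johnston2010, §2.1] -/
theorem metalDistance_sq (a : ℝ) : metalDistance a ^ 2 = (a / 2) ^ 2 + (a / 2) ^ 2 := by
  unfold metalDistance
  rw [div_pow, Real.sq_sqrt (by norm_num : (0:ℝ) ≤ 2)]
  ring

/-- The height is nonnegative. [cite: Johnston2010, §2.1 Eqs. (Eqtheta)] -/
theorem height_nonneg (z α c : ℝ) (hc : 0 ≤ c) : 0 ≤ height z α c := by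
  unfold height
  exact mul_nonneg (abs_nonneg _) hc

/-- For the 122-type cell (`α = 1/4`) with `z ≥ 1/4`: `h = (z − 1/4)c`; e.g. `BaFe₂As₂`
(`z = 0.35393`, `c = 13.001 Å` gives `h = 1.352 Å`). [cite: Johnston2010, §2.1 and Table (data5)] -/
theorem height_122 (z c : ℝ) (hz : 1 / 4 ≤ z) : height z (1 / 4) c = (z - 1 / 4) * c := by
  unfold height
  rw [abs_of_nonneg (by linarith)]

/-- For the 1111-type cell (`α = 1/2`) with `z ≥ 1/2`: `h = (z − 1/2)c`; e.g. `LaFeAsO`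
(`z = 0.6512`, `c = 8.7409 Å` gives `h = 1.322 Å`). [cite: Johnston2010, §2.1 and Table (data4)] -/
theorem height_1111 (z c : ℝ) (hz : 1 / 2 ≤ z) : height z (1 / 2) c = (z - 1 / 2) * c := by
  unfold height
  rw [abs_of_nonneg (by linarith)]

/-- For the 11-type cell (`α = 0`) with `z ≥ 0`: `h = z c`; e.g. `Fe₁₊yTe` (`z = 0.2792`, `c = 6.2851 Å`
gives `h = 1.755 Å`). [cite: Johnston2010, §2.1 and Table (data6)] -/
theorem height_11 (z c : ℝ) (hz : 0 ≤ z) : height z 0 c = z * c := by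
  unfold height
  rw [sub_zero, abs_of_nonneg hz]

/-! ## The exact relation between the two angles -/

/-- **`cos θ₂ + 2 cos θ₄ = −1`** identically (for a non-degenerate cell): the exact content of «the average
bond angle for all six X-M-X bonds is close to 109.47° … if `θ₂ > 109.47°` then `θ₄ < 109.47°`, and vice
versa». [cite: Johnston2010, §2.1 (sentence after Eqs. (Eqtheta))] -/
theorem cosTwofold_add_two_mul_cosFourfold (a h : ℝ) (ha : a ≠ 0) :
    cosTwofold a h + 2 * cosFourfold a h = -1 := by
  have hd : a ^ 2 / 4 + h ^ 2 ≠ 0 := (denom_pos h ha).ne'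
  unfold cosTwofold cosFourfold
  field_simp
  ring

/-- Equivalent form: `cos θ₄ = −(1 + cos θ₂)/2`. [cite: Johnston2010, §2.1 (sentence after Eqs. (Eqtheta))] -/
theorem cosFourfold_eq (a h : ℝ) (ha : a ≠ 0) :
    cosFourfold a h = -(1 + cosTwofold a h) / 2 := by
  have := cosTwofold_add_two_mul_cosFourfold a h ha
  linarith

/-- `cos θ₂ < −1/3 ⇔ cos θ₄ > −1/3` (the cosine form of «`θ₂ > 109.47°` iff `θ₄ < 109.47°`»).
[cite: Johnston2010, §2.1 (sentence after Eqs. (Eqtheta))] -/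
theorem cosTwofold_lt_iff (a h : ℝ) (ha : a ≠ 0) :
    cosTwofold a h < -1 / 3 ↔ -1 / 3 < cosFourfold a h := by
  rw [cosFourfold_eq a h ha]
  constructor <;> intro H <;> linarith

/-! ## Ranges of the two cosines -/

/-- `−1 ≤ cos θ₂ ≤ 1` (indeed `cos θ₂ < 1` for `a ≠ 0`). [cite: Johnston2010, §2.1 Eqs. (Eqtheta)] -/
theorem cosTwofold_mem_Icc (a h : ℝ) (ha : a ≠ 0) : cosTwofold a h ∈ Set.Icc (-1 : ℝ) 1 := by
  have hd := denom_pos h ha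
  unfold cosTwofold
  constructor
  · rw [le_div_iff₀ hd]; nlinarith [sq_nonneg h]
  · rw [div_le_iff₀ hd]; nlinarith [sq_nonneg a]

/-- `−1 ≤ cos θ₄ ≤ 0` (the fourfold angle is obtuse or right). [cite: Johnston2010, §2.1 Eqs. (Eqtheta)] -/
theorem cosFourfold_mem_Icc (a h : ℝ) (ha : a ≠ 0) : cosFourfold a h ∈ Set.Icc (-1 : ℝ) 0 := by
  have hd := denom_pos h ha
  unfold cosFourfold
  constructor
  · rw [le_div_iff₀ hd]; nlinarith [sq_nonneg a]
  · rw [div_le_iff₀ hd]; nlinarith [sq_nonneg h]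

/-- `−1/3 ∈ [−1, 1]`. [folklore] -/
private lemma neg_third_mem : (-1 / 3 : ℝ) ∈ Set.Icc (-1 : ℝ) 1 := by
  constructor <;> norm_num

/-! ## Regularity: `θ₂ = θ₄ = arccos(−1/3)` exactly when `h = a/(2√2)` -/

/-- `cos θ₂ = −1/3 ⇔ h² = a²/8`. [cite: Johnston2010, §2.2 and Fig. (TcAngle) caption («equal twofold and
fourfold … bond angles of arccos(−1/3) ≈ 109.47° for an undistorted … tetrahedron»)] -/
theorem cosTwofold_eq_neg_third_iff (a h : ℝ) (ha : a ≠ 0) :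
    cosTwofold a h = -1 / 3 ↔ h ^ 2 = a ^ 2 / 8 := by
  have hd : a ^ 2 / 4 + h ^ 2 ≠ 0 := (denom_pos h ha).ne'
  unfold cosTwofold
  rw [div_eq_iff hd]
  constructor <;> intro H <;> linarith

/-- `cos θ₄ = −1/3 ⇔ h² = a²/8`. [cite: Johnston2010, §2.2 and Fig. (TcAngle) caption] -/
theorem cosFourfold_eq_neg_third_iff (a h : ℝ) (ha : a ≠ 0) :
    cosFourfold a h = -1 / 3 ↔ h ^ 2 = a ^ 2 / 8 := by
  have hd : a ^ 2 / 4 + h ^ 2 ≠ 0 := (denom_pos h ha).ne'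
  unfold cosFourfold
  rw [div_eq_iff hd]
  constructor <;> intro H <;> linarith

/-- The tetrahedron is regular (`θ₂ = θ₄`) iff `h² = a²/8`. [cite: Johnston2010, Fig. (TcAngle) caption] -/
theorem cosTwofold_eq_cosFourfold_iff (a h : ℝ) (ha : a ≠ 0) :
    cosTwofold a h = cosFourfold a h ↔ h ^ 2 = a ^ 2 / 8 := by
  rw [cosFourfold_eq a h ha]
  constructor
  · intro H
    exact (cosTwofold_eq_neg_third_iff a h ha).1 (by linarith)
  · intro H
    have := (cosTwofold_eq_neg_third_iff a h ha).2 H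
    linarith

/-- For positive lengths, `h² = a²/8 ⇔ h = a/(2√2)` (the regular-tetrahedron height, `h/a ≈ 0.3536`).
[cite: Johnston2010, §2.2–2.3 (bond angle vs pnictogen height)] -/
theorem sq_eq_iff_height_eq (a h : ℝ) (ha : 0 < a) (hh : 0 ≤ h) :
    h ^ 2 = a ^ 2 / 8 ↔ h = a / (2 * Real.sqrt 2) := by
  have hs : (0 : ℝ) < Real.sqrt 2 := by positivity
  have hs2 : Real.sqrt 2 ^ 2 = 2 := Real.sq_sqrt (by norm_num)
  have key : (a / (2 * Real.sqrt 2)) ^ 2 = a ^ 2 / 8 := by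
    rw [div_pow, mul_pow, hs2]; ring
  constructor
  · intro H
    have hpos : 0 ≤ a / (2 * Real.sqrt 2) := by positivity
    have : h ^ 2 = (a / (2 * Real.sqrt 2)) ^ 2 := by rw [key, H]
    exact (pow_left_inj₀ hh hpos (by norm_num : (2:ℕ) ≠ 0)).1 this
  · intro H
    rw [H, key]

/-- Angle form: `θ₂ = arccos(−1/3)` iff `h² = a²/8` (arccos is injective on `[−1, 1]`).
[cite: Johnston2010, Fig. (TcAngle) caption; LeeEtAl2008 (regular `FeAs₄` tetrahedron)] -/
theorem twofoldAngle_eq_tetrahedral_iff (a h : ℝ) (ha : a ≠ 0) :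
    twofoldAngle a h = tetrahedralAngle ↔ h ^ 2 = a ^ 2 / 8 := by
  rw [← cosTwofold_eq_neg_third_iff a h ha]
  unfold twofoldAngle tetrahedralAngle
  constructor
  · intro H
    exact Real.arccos_injOn (cosTwofold_mem_Icc a h ha) neg_third_mem H
  · intro H
    rw [H]

/-- Likewise `θ₄ = arccos(−1/3)` iff `h² = a²/8`. [cite: Johnston2010, Fig. (TcAngle) caption] -/
theorem fourfoldAngle_eq_tetrahedral_iff (a h : ℝ) (ha : a ≠ 0) :
    fourfoldAngle a h = tetrahedralAngle ↔ h ^ 2 = a ^ 2 / 8 := by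
  rw [← cosFourfold_eq_neg_third_iff a h ha]
  unfold fourfoldAngle tetrahedralAngle
  have hm : cosFourfold a h ∈ Set.Icc (-1 : ℝ) 1 := by
    obtain ⟨h1, h2⟩ := cosFourfold_mem_Icc a h ha
    exact ⟨h1, by linarith⟩
  constructor
  · intro H
    exact Real.arccos_injOn hm neg_third_mem H
  · intro H
    rw [H]

/-- **Johnston's dichotomy, as printed**: `θ₂ > arccos(−1/3)` iff `θ₄ < arccos(−1/3)` («if `θ₂ > 109.47°`
then `θ₄ < 109.47°`, and vice versa»). [cite: Johnston2010, §2.1 (sentence after Eqs. (Eqtheta))] -/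
theorem tetrahedralAngle_lt_twofoldAngle_iff (a h : ℝ) (ha : a ≠ 0) :
    tetrahedralAngle < twofoldAngle a h ↔ fourfoldAngle a h < tetrahedralAngle := by
  have hm4 : cosFourfold a h ∈ Set.Icc (-1 : ℝ) 1 := by
    obtain ⟨h1, h2⟩ := cosFourfold_mem_Icc a h ha
    exact ⟨h1, by linarith⟩
  unfold twofoldAngle fourfoldAngle tetrahedralAngle
  rw [Real.strictAntiOn_arccos.lt_iff_gt neg_third_mem (cosTwofold_mem_Icc a h ha),
    Real.strictAntiOn_arccos.lt_iff_gt hm4 neg_third_mem]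
  exact cosTwofold_lt_iff a h ha

/-! ## Monotonicity in the pnictogen height -/

/-- At fixed `a ≠ 0`, `cos θ₂ = 1 − (a²/2)/(a²/4 + h²)` is strictly increasing in `h ≥ 0`. [cite: Johnston2010,
§2.3 (pnictogen height)] -/
theorem cosTwofold_strictMonoOn (a : ℝ) (ha : a ≠ 0) :
    StrictMonoOn (fun h => cosTwofold a h) (Set.Ici 0) := by
  intro x hx y hy hxy
  have hx0 : 0 ≤ x := hx
  have hdx := denom_pos x ha
  have hdy := denom_pos y ha
  have ha2 : 0 < a ^ 2 := by positivity
  have hxy2 : x ^ 2 < y ^ 2 := by nlinarith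
  show cosTwofold a x < cosTwofold a y
  unfold cosTwofold
  rw [div_lt_div_iff₀ hdx hdy]
  nlinarith

/-- At fixed `a ≠ 0`, `cos θ₄ = −1 + (a²/4)/(a²/4 + h²)` is strictly decreasing in `h ≥ 0`.
[cite: Johnston2010, §2.3 (pnictogen height)] -/
theorem cosFourfold_strictAntiOn (a : ℝ) (ha : a ≠ 0) :
    StrictAntiOn (fun h => cosFourfold a h) (Set.Ici 0) := by
  intro x hx y hy hxy
  have hx0 : 0 ≤ x := hx
  have hdx := denom_pos x ha
  have hdy := denom_pos y ha
  have ha2 : 0 < a ^ 2 := by positivity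
  have hxy2 : x ^ 2 < y ^ 2 := by nlinarith
  show cosFourfold a y < cosFourfold a x
  unfold cosFourfold
  rw [div_lt_div_iff₀ hdy hdx]
  nlinarith

/-- **A taller pnictogen closes the twofold angle**: at fixed `a ≠ 0`, `θ₂` is strictly decreasing in
`h ≥ 0`. [cite: Johnston2010, §2.3 (pnictogen height); Table (data6) (`Fe₁₊yTe`: `h = 1.755 Å`, `θ₂ = 94.88°`)
vs Table (data4) (`LaFeAsO`: `h = 1.322 Å`, `θ₂ = 113.5°`)] -/
theorem twofoldAngle_strictAntiOn (a : ℝ) (ha : a ≠ 0) :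
    StrictAntiOn (fun h => twofoldAngle a h) (Set.Ici 0) := by
  intro x hx y hy hxy
  show Real.arccos (cosTwofold a y) < Real.arccos (cosTwofold a x)
  exact Real.strictAntiOn_arccos (cosTwofold_mem_Icc a x ha) (cosTwofold_mem_Icc a y ha)
    (cosTwofold_strictMonoOn a ha hx hy hxy)

/-- … and opens the fourfold angle: `θ₄` is strictly increasing in `h ≥ 0`. [cite: Johnston2010, §2.3] -/
theorem fourfoldAngle_strictMonoOn (a : ℝ) (ha : a ≠ 0) :
    StrictMonoOn (fun h => fourfoldAngle a h) (Set.Ici 0) := by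
  intro x hx y hy hxy
  have hmx : cosFourfold a x ∈ Set.Icc (-1 : ℝ) 1 := by
    obtain ⟨h1, h2⟩ := cosFourfold_mem_Icc a x ha
    exact ⟨h1, by linarith⟩
  have hmy : cosFourfold a y ∈ Set.Icc (-1 : ℝ) 1 := by
    obtain ⟨h1, h2⟩ := cosFourfold_mem_Icc a y ha
    exact ⟨h1, by linarith⟩
  show Real.arccos (cosFourfold a x) < Real.arccos (cosFourfold a y)
  exact Real.strictAntiOn_arccos hmy hmx (cosFourfold_strictAntiOn a ha hx hy hxy)

/-- Regularity threshold in the height: for `a > 0`, `h ≥ 0`, `θ₂ > arccos(−1/3)` iff `h² < a²/8`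
(pnictogen lower than the regular height `a/(2√2)`). [cite: Johnston2010, §2.2–2.3; KimberEtAl2009] -/
theorem tetrahedralAngle_lt_twofoldAngle_iff_sq_lt (a h : ℝ) (ha : a ≠ 0) :
    tetrahedralAngle < twofoldAngle a h ↔ h ^ 2 < a ^ 2 / 8 := by
  have hd := denom_pos h ha
  unfold twofoldAngle tetrahedralAngle
  rw [Real.strictAntiOn_arccos.lt_iff_gt neg_third_mem (cosTwofold_mem_Icc a h ha)]
  unfold cosTwofold
  rw [div_lt_iff₀ hd]
  constructor <;> intro H <;> linarith

/-- … and `θ₂ < arccos(−1/3)` iff `h² > a²/8`. [cite: Johnston2010, §2.2–2.3] -/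
theorem twofoldAngle_lt_tetrahedralAngle_iff_lt_sq (a h : ℝ) (ha : a ≠ 0) :
    twofoldAngle a h < tetrahedralAngle ↔ a ^ 2 / 8 < h ^ 2 := by
  have hd := denom_pos h ha
  unfold twofoldAngle tetrahedralAngle
  rw [Real.strictAntiOn_arccos.lt_iff_gt (cosTwofold_mem_Icc a h ha) neg_third_mem]
  unfold cosTwofold
  rw [lt_div_iff₀ hd]
  constructor <;> intro H <;> linarith

/-! ## Inversion: the height from the twofold angle -/

/-- `h² = (a²/4)(1 + cos θ₂)/(1 − cos θ₂)` — the structure refiners' inversion of the printed formula (for a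
non-degenerate cell `cos θ₂ ≠ 1`). [cite: Johnston2010, §2.1 Eqs. (Eqtheta)] -/
theorem height_sq_eq_of_cosTwofold (a h : ℝ) (ha : a ≠ 0) :
    h ^ 2 = (a ^ 2 / 4) * (1 + cosTwofold a h) / (1 - cosTwofold a h) := by
  have hd : a ^ 2 / 4 + h ^ 2 ≠ 0 := (denom_pos h ha).ne'
  have ha2 : 0 < a ^ 2 := by positivity
  have h1 : 1 - cosTwofold a h = (a ^ 2 / 2) / (a ^ 2 / 4 + h ^ 2) := by
    unfold cosTwofold; field_simp; ring
  have h2 : 1 + cosTwofold a h = (2 * h ^ 2) / (a ^ 2 / 4 + h ^ 2) := by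
    unfold cosTwofold; field_simp; ring
  rw [h1, h2]
  field_simp
  ring

/-! ## Kernel inequalities for cells quoted in the hubbard-downfold tables

Each is a decidable statement about the printed `(a, h)` of one Appendix row of [Johnston2010] (or, for
`CsFe₂As₂`, the height derived from Eilers et al. 2016's `a = 3.902 Å`, `c = 15.14 Å`, `z = 0.3416`), and
converts to the angle statement by `tetrahedralAngle_lt_twofoldAngle_iff_sq_lt` /
`twofoldAngle_lt_tetrahedralAngle_iff_lt_sq`. -/

/-- `BaFe₂As₂` (297 K: `a = 3.9625 Å`, `h = 1.360 Å`, printed `θ₂ = 111.1°`): `h² < a²/8`, hence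
`θ₂ > arccos(−1/3)`. [cite: Johnston2010, Appendix Table (data5), row BaFe₂As₂ (Rotter et al. 2008b)] -/
theorem baFe2As2_twofold_gt :
    tetrahedralAngle < twofoldAngle (39625 / 10000) (1360 / 1000) := by
  rw [tetrahedralAngle_lt_twofoldAngle_iff_sq_lt _ _ (by norm_num)]
  norm_num

/-- `NdFeAsO₀.₈₃` at 10 K (`a = 3.9423 Å`, `h = 1.382 Å`, printed `θ₂ = 109.91°`, `T_c = 51 K` — the
highest-`T_c` row of Lee et al.'s series, closest to regular): still `h² < a²/8`, `θ₂ > arccos(−1/3)`.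
[cite: Johnston2010, Appendix Table (data4), row NdFeAsO₀.₈₃ (10 K); LeeEtAl2008] -/
theorem ndFeAsO_twofold_gt :
    tetrahedralAngle < twofoldAngle (39423 / 10000) (1382 / 1000) := by
  rw [tetrahedralAngle_lt_twofoldAngle_iff_sq_lt _ _ (by norm_num)]
  norm_num

/-- `Fe₁₊yTe` (300 K: `a = 3.8219 Å`, `h = 1.755 Å`, printed `θ₂ = 94.88°`): `h² > a²/8`, hence
`θ₂ < arccos(−1/3)` (the tall-chalcogen, compressed-angle end of the family). [cite: Johnston2010, Appendix
Table (data6), row Fe₁₊yTe (Martinelli et al. 2010)] -/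
theorem feTe_twofold_lt :
    twofoldAngle (38219 / 10000) (1755 / 1000) < tetrahedralAngle := by
  rw [twofoldAngle_lt_tetrahedralAngle_iff_lt_sq _ _ (by norm_num)]
  norm_num

/-- `CsFe₂As₂` (`a = 3.902 Å`, `h = (0.3416 − 1/4)·15.14 = 1.386824 Å`): `h² > a²/8` by a small margin,
hence `θ₂ < arccos(−1/3)` (derived `θ₂ ≈ 109.2°`). [cite: Johnston2010, §2.1 Eqs. (Eqtheta) (formula); cell from
Eilers et al., PRL 116, 237003 (2016), Suppl. (structure refinement)] -/
theorem csFe2As2_twofold_lt :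
    twofoldAngle (3902 / 1000) (1386824 / 1000000) < tetrahedralAngle := by
  rw [twofoldAngle_lt_tetrahedralAngle_iff_lt_sq _ _ (by norm_num)]
  norm_num

/-- The `CsFe₂As₂` height used above IS `(z − 1/4)c` for the printed `z = 0.3416`, `c = 15.14`.
[cite: Johnston2010, §2.1 Eqs. (Eqtheta)] -/
theorem csFe2As2_height : height (3416 / 10000) (1 / 4) (1514 / 100) = 1386824 / 1000000 := by
  rw [height_122 _ _ (by norm_num)]
  norm_num

/-! ## §8 The asymmetric `MX₄` tetrahedron of the 1144 structure (appended 2026-08-27, lit-4 g14)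

In the ordered `AeAFe₄As₄` («1144») structures, space group `P4/mmm`, the two intercalant layers sandwiching
an `FeAs` layer differ (Ca/K in `CaKFe₄As₄`, Eu/Rb in `RbEuFe₄As₄`), so the two `X` atoms ABOVE the metal plane
(site As1, height `h₁`) and the two BELOW it (site As2, height `h₂`) are crystallographically inequivalent:
«the local coordination environment for Fe atoms turns out to be asymmetric … the Fe−As bondlengths are no
longer equal» [LiuEtAl2016RbEuFe4As4, p. 3 and TABLE I]; «the Fe atom is no longer located at the center of the
tetrahedral formed by the 4 closest As atoms … the `S₄` local symmetry around each Fe is reduced to `C₂`»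
(Xu–Chen–Cao 2019 on the same cell). With `X` positions `(0, ±a/2, h₁)` (upper pair) and `(±a/2, 0, −h₂)`
(lower pair) relative to `M`, the six `X–M–X` angles of one tetrahedron are

* ONE twofold As1–M–As1 angle = `twofoldAngle a h₁`,
* ONE twofold As2–M–As2 angle = `twofoldAngle a h₂`,
* FOUR mixed As1–M–As2 angles with `cos θ_m = −h₁h₂/(r₁ r₂)`, `rᵢ = bondLength a hᵢ` — `cosMixed` below,

and the symmetric dictionary of §1–§7 is the case `h₁ = h₂` (`cosMixed a h h = cosFourfold a h`). The exact
content typed here: the cosine rule for the mixed pair; the range `−1 < cos θ_m ≤ 0`; the ASYMMETRIC SUM RULE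
`cos θ₂(h₁) + cos θ₂(h₂) + 4 cos θ_m = −2 + 2 (h₁/r₁ − h₂/r₂)²`, hence `≥ −2` with equality iff `h₁ = h₂`
(when it is Johnston's `cos θ₂ + 2 cos θ₄ = −1`); and decidable witnesses for the two refined 1144 cells of the
hubbard-downfold tables — `RbEuFe₄As₄` [LiuEtAl2016RbEuFe4As4, TABLE I: `a = 3.8897`, `c = 13.3146 Å`,
`z_Fe = 0.2404`, `z_As1 = 0.3342`, `z_As2 = 0.1300`] and `CaKFe₄As₄` [MouEtAl2016CaKFe4As4, TABLE I:
`a = 3.8659`, `c = 12.884 Å`, `z_Fe = 0.7682 ≡ 0.2318`, `z_As1 = 0.3415`, `z_As2 = 0.1231`] — including the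
reading of Liu et al.'s printed angle pair «As1−Fe−As1 and As2−Fe−As2 are 112.50° and 109.04°»: on the TABLE I
coordinates the As1 twofold angle exceeds `5π/8 = 112.5°` strictly (it is `114.59°`), the As2 twofold angle is
below `3π/5 = 108°` (it is `105.84°`), and it is the MIXED angle that lies in `(108°, arccos(−1/3))` (`109.01°`).
WHAT THIS IS NOT: a structure refinement or a claim about which printed number is «right» — the coordinates are
inputs; the theorems say which printed angles are functions of them. -/

/-- cos of a MIXED `X₁–M–X₂` angle of the asymmetric tetrahedron (one `X` above at height `h₁`, one below at
height `h₂`): `−h₁h₂/(r₁r₂)`. [cite: LiuEtAl2016RbEuFe4As4, p. 3 (asymmetric Fe coordination, TABLE I)];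
[cite: Johnston2010, §2.1 Eqs. (Eqtheta) (the `h₁ = h₂` case `cos θ₄ = −h²/r²`)] -/
def cosMixed (a h₁ h₂ : ℝ) : ℝ := -(h₁ * h₂) / (bondLength a h₁ * bondLength a h₂)

/-- The mixed `X₁–M–X₂` bond angle `θ_m = arccos(cos θ_m)`. [cite: LiuEtAl2016RbEuFe4As4, p. 3] -/
def mixedAngle (a h₁ h₂ : ℝ) : ℝ := Real.arccos (cosMixed a h₁ h₂)

/-- `cosMixed` IS the cosine rule `⟪X₁, X₃⟫/(|X₁| |X₃|)` for `X₁ = (0, a/2, h₁)` (upper) and `X₃ = (a/2, 0, −h₂)`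
(lower). [cite: Johnston2010, §2.1 Eqs. (Eqtheta)]; [cite: LiuEtAl2016RbEuFe4As4, TABLE I] -/
theorem cosMixed_eq_dot (a h₁ h₂ : ℝ) :
    cosMixed a h₁ h₂ =
      (0 * (a / 2) + (a / 2) * 0 + h₁ * (-h₂)) / (bondLength a h₁ * bondLength a h₂) := by
  unfold cosMixed
  ring

/-- The mixed cosine is symmetric under exchanging the two heights. [cite: LiuEtAl2016RbEuFe4As4, p. 3] -/
theorem cosMixed_comm (a h₁ h₂ : ℝ) : cosMixed a h₁ h₂ = cosMixed a h₂ h₁ := by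
  unfold cosMixed
  ring

/-- **Reduction to Johnston's dictionary**: for equal heights the mixed angle IS the fourfold angle,
`cosMixed a h h = cosFourfold a h = −h²/r²`. [cite: Johnston2010, §2.1 Eqs. (Eqtheta)] -/
theorem cosMixed_self (a h : ℝ) : cosMixed a h h = cosFourfold a h := by
  have h0 : 0 ≤ a ^ 2 / 4 + h ^ 2 := by positivity
  unfold cosMixed cosFourfold bondLength
  rw [Real.mul_self_sqrt h0]
  ring

/-- `mixedAngle a h h = fourfoldAngle a h`. [cite: Johnston2010, §2.1 Eqs. (Eqtheta)] -/
theorem mixedAngle_self (a h : ℝ) : mixedAngle a h h = fourfoldAngle a h := by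
  unfold mixedAngle fourfoldAngle
  rw [cosMixed_self]

/-- `r = bondLength a h > 0` for `a ≠ 0`. [cite: Johnston2010, §2.1 Eqs. (Eqtheta)] -/
theorem bondLength_pos (a h : ℝ) (ha : a ≠ 0) : 0 < bondLength a h := by
  unfold bondLength
  exact Real.sqrt_pos.mpr (denom_pos h ha)

/-- `h < r` for `a ≠ 0`, `h ≥ 0` (the bond is longer than the height). [cite: Johnston2010, §2.1] -/
theorem lt_bondLength (a h : ℝ) (ha : a ≠ 0) (hh : 0 ≤ h) : h < bondLength a h := by
  unfold bondLength
  rw [Real.lt_sqrt hh]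
  have : 0 < a ^ 2 := by positivity
  linarith

/-- `cosMixed = −(h₁/r₁)(h₂/r₂)`: the product form used in the sum rule. [cite: LiuEtAl2016RbEuFe4As4, p. 3] -/
theorem cosMixed_eq_neg_mul (a h₁ h₂ : ℝ) :
    cosMixed a h₁ h₂ = -((h₁ / bondLength a h₁) * (h₂ / bondLength a h₂)) := by
  unfold cosMixed
  ring

/-- `cos θ₂ = 2 (h/r)² − 1`: the twofold cosine in terms of the height-to-bond ratio. [cite: Johnston2010,
§2.1 Eqs. (Eqtheta)] -/
theorem cosTwofold_eq_ratio (a h : ℝ) (ha : a ≠ 0) :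
    cosTwofold a h = 2 * (h / bondLength a h) ^ 2 - 1 := by
  have hd := denom_pos h ha
  have hr2 : bondLength a h ^ 2 = a ^ 2 / 4 + h ^ 2 := by
    unfold bondLength; exact Real.sq_sqrt hd.le
  rw [div_pow, hr2]
  unfold cosTwofold
  field_simp
  ring

/-- Range of the mixed cosine for nonnegative heights: `−1 < cos θ_m ≤ 0` (an upper/lower pair always makes
an angle in `[90°, 180°)`; `= 0` iff one height vanishes). [cite: LiuEtAl2016RbEuFe4As4, p. 3]; [cite: Johnston2010, §2.1] -/
theorem cosMixed_mem_Ioc (a h₁ h₂ : ℝ) (ha : a ≠ 0) (hh₁ : 0 ≤ h₁) (hh₂ : 0 ≤ h₂) :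
    cosMixed a h₁ h₂ ∈ Set.Ioc (-1 : ℝ) 0 := by
  have hr₁ := bondLength_pos a h₁ ha
  have hr₂ := bondLength_pos a h₂ ha
  have hu : 0 ≤ h₁ / bondLength a h₁ := div_nonneg hh₁ hr₁.le
  have hv : 0 ≤ h₂ / bondLength a h₂ := div_nonneg hh₂ hr₂.le
  have hu1 : h₁ / bondLength a h₁ < 1 := by
    rw [div_lt_one hr₁]; exact lt_bondLength a h₁ ha hh₁
  have hv1 : h₂ / bondLength a h₂ < 1 := by
    rw [div_lt_one hr₂]; exact lt_bondLength a h₂ ha hh₂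
  rw [cosMixed_eq_neg_mul]
  constructor
  · have : (h₁ / bondLength a h₁) * (h₂ / bondLength a h₂) < 1 := by nlinarith
    linarith
  · nlinarith

/-- **THE ASYMMETRIC SUM RULE**: `cos θ₂(h₁) + cos θ₂(h₂) + 4 cos θ_m = −2 + 2 (h₁/r₁ − h₂/r₂)²` (the six
unit bond vectors sum to `(0, 0, 2h₁/r₁ − 2h₂/r₂)`). For `h₁ = h₂` the right side is `−2` and the left is
`2 cos θ₂ + 4 cos θ₄`: Johnston's `cos θ₂ + 2 cos θ₄ = −1`. [cite: Johnston2010, §2.1 (sentence after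
Eqs. (Eqtheta))]; [cite: LiuEtAl2016RbEuFe4As4, TABLE I] -/
theorem cosTwofold_add_cosTwofold_add_four_mul_cosMixed (a h₁ h₂ : ℝ) (ha : a ≠ 0) :
    cosTwofold a h₁ + cosTwofold a h₂ + 4 * cosMixed a h₁ h₂ =
      -2 + 2 * (h₁ / bondLength a h₁ - h₂ / bondLength a h₂) ^ 2 := by
  rw [cosTwofold_eq_ratio a h₁ ha, cosTwofold_eq_ratio a h₂ ha, cosMixed_eq_neg_mul]
  ring

/-- The six-angle cosine sum is `≥ −2` … [cite: Johnston2010, §2.1] -/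
theorem neg_two_le_angleSum (a h₁ h₂ : ℝ) (ha : a ≠ 0) :
    -2 ≤ cosTwofold a h₁ + cosTwofold a h₂ + 4 * cosMixed a h₁ h₂ := by
  rw [cosTwofold_add_cosTwofold_add_four_mul_cosMixed a h₁ h₂ ha]
  nlinarith [sq_nonneg (h₁ / bondLength a h₁ - h₂ / bondLength a h₂)]

/-- The height-to-bond ratio `h/r = h/√(a²/4 + h²)` determines `h` (for `h ≥ 0`, `a ≠ 0`): equal ratios iff
equal heights. [cite: Johnston2010, §2.1 Eqs. (Eqtheta)] -/
theorem div_bondLength_eq_iff (a h₁ h₂ : ℝ) (ha : a ≠ 0) (hh₁ : 0 ≤ h₁) (hh₂ : 0 ≤ h₂) :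
    h₁ / bondLength a h₁ = h₂ / bondLength a h₂ ↔ h₁ = h₂ := by
  constructor
  · intro H
    have hr₁ := bondLength_pos a h₁ ha
    have hr₂ := bondLength_pos a h₂ ha
    have hsq₁ : bondLength a h₁ ^ 2 = a ^ 2 / 4 + h₁ ^ 2 := by
      unfold bondLength; exact Real.sq_sqrt (denom_pos h₁ ha).le
    have hsq₂ : bondLength a h₂ ^ 2 = a ^ 2 / 4 + h₂ ^ 2 := by
      unfold bondLength; exact Real.sq_sqrt (denom_pos h₂ ha).le
    have H2 : (h₁ / bondLength a h₁) ^ 2 = (h₂ / bondLength a h₂) ^ 2 := by rw [H]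
    rw [div_pow, div_pow, hsq₁, hsq₂, div_eq_div_iff (denom_pos h₁ ha).ne' (denom_pos h₂ ha).ne'] at H2
    have ha2 : 0 < a ^ 2 := by positivity
    have hsq : h₁ ^ 2 = h₂ ^ 2 := by nlinarith
    nlinarith [sq_nonneg (h₁ - h₂), sq_nonneg (h₁ + h₂)]
  · intro H; rw [H]

/-- … with EQUALITY `= −2` iff the tetrahedron is height-symmetric, `h₁ = h₂` (nonnegative heights) — the
1144 asymmetry is measured exactly by the excess `2 (h₁/r₁ − h₂/r₂)²`. [cite: Johnston2010, §2.1];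
[cite: LiuEtAl2016RbEuFe4As4, p. 3] -/
theorem angleSum_eq_neg_two_iff (a h₁ h₂ : ℝ) (ha : a ≠ 0) (hh₁ : 0 ≤ h₁) (hh₂ : 0 ≤ h₂) :
    cosTwofold a h₁ + cosTwofold a h₂ + 4 * cosMixed a h₁ h₂ = -2 ↔ h₁ = h₂ := by
  rw [cosTwofold_add_cosTwofold_add_four_mul_cosMixed a h₁ h₂ ha, ← div_bondLength_eq_iff a h₁ h₂ ha hh₁ hh₂]
  constructor
  · intro H
    have : (h₁ / bondLength a h₁ - h₂ / bondLength a h₂) ^ 2 = 0 := by linarith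
    have := pow_eq_zero_iff (n := 2) (by norm_num) |>.mp this
    linarith
  · intro H; rw [H]; ring

/-- The mixed angle exceeds the regular-tetrahedron angle iff `cos θ_m < −1/3`. [cite: Johnston2010, §2.1] -/
theorem tetrahedralAngle_lt_mixedAngle_iff (a h₁ h₂ : ℝ) (ha : a ≠ 0) (hh₁ : 0 ≤ h₁) (hh₂ : 0 ≤ h₂) :
    tetrahedralAngle < mixedAngle a h₁ h₂ ↔ cosMixed a h₁ h₂ < -1 / 3 := by
  have hm : cosMixed a h₁ h₂ ∈ Set.Icc (-1 : ℝ) 1 := by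
    obtain ⟨h1, h2⟩ := cosMixed_mem_Ioc a h₁ h₂ ha hh₁ hh₂
    exact ⟨h1.le, by linarith⟩
  unfold mixedAngle tetrahedralAngle
  rw [Real.strictAntiOn_arccos.lt_iff_gt neg_third_mem hm]

/-- … and is below it iff `cos θ_m > −1/3`. [cite: Johnston2010, §2.1] -/
theorem mixedAngle_lt_tetrahedralAngle_iff (a h₁ h₂ : ℝ) (ha : a ≠ 0) (hh₁ : 0 ≤ h₁) (hh₂ : 0 ≤ h₂) :
    mixedAngle a h₁ h₂ < tetrahedralAngle ↔ -1 / 3 < cosMixed a h₁ h₂ := by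
  have hm : cosMixed a h₁ h₂ ∈ Set.Icc (-1 : ℝ) 1 := by
    obtain ⟨h1, h2⟩ := cosMixed_mem_Ioc a h₁ h₂ ha hh₁ hh₂
    exact ⟨h1.le, by linarith⟩
  unfold mixedAngle tetrahedralAngle
  rw [Real.strictAntiOn_arccos.lt_iff_gt hm neg_third_mem]

/-! ### Two printed reference angles: `5π/8 = 112.5°` and `3π/5 = 108°` -/

/-- `cos 112.5° = cos(5π/8) = −sin(π/8) = −√(2 − √2)/2` — the exact cosine of Liu et al.'s printed As1–Fe–As1 angle
«112.50°» (via Mathlib `Real.sin_pi_div_eight`). [cite: LiuEtAl2016RbEuFe4As4, p. 3 («112.50°»)] -/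
theorem cos_five_pi_div_eight : Real.cos (5 * Real.pi / 8) = -(Real.sqrt (2 - Real.sqrt 2) / 2) := by
  have : 5 * Real.pi / 8 = Real.pi / 8 + Real.pi / 2 := by ring
  rw [this, Real.cos_add_pi_div_two, Real.sin_pi_div_eight]

/-- `−0.3827 < cos 112.5° < −0.3826`. [cite: LiuEtAl2016RbEuFe4As4, p. 3 («112.50°»)] -/
theorem cos_five_pi_div_eight_bounds :
    -0.3827 < Real.cos (5 * Real.pi / 8) ∧ Real.cos (5 * Real.pi / 8) < -0.3826 := by
  rw [cos_five_pi_div_eight]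
  have h2lo : (1.41421 : ℝ) < Real.sqrt 2 := by rw [Real.lt_sqrt (by norm_num)]; norm_num
  have h2hi : Real.sqrt 2 < (1.41422 : ℝ) := by rw [Real.sqrt_lt' (by norm_num)]; norm_num
  have hlo : (0.7652 : ℝ) < Real.sqrt (2 - Real.sqrt 2) := by
    rw [Real.lt_sqrt (by norm_num)]; nlinarith
  have hhi : Real.sqrt (2 - Real.sqrt 2) < (0.7654 : ℝ) := by
    rw [Real.sqrt_lt' (by norm_num)]; nlinarith
  constructor <;> linarith

/-- `cos 108° = cos(3π/5) = −(√5 − 1)/4` — the exact reference angle just below Liu et al.'s printed «109.04°» (via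
Mathlib `Real.cos_pi_div_five`). [cite: LiuEtAl2016RbEuFe4As4, p. 3 («109.04°»)] -/
theorem cos_three_pi_div_five : Real.cos (3 * Real.pi / 5) = -((Real.sqrt 5 - 1) / 4) := by
  have h1 : 3 * Real.pi / 5 = Real.pi - 2 * (Real.pi / 5) := by ring
  rw [h1, Real.cos_pi_sub, Real.cos_two_mul, Real.cos_pi_div_five]
  have h5 : Real.sqrt 5 ^ 2 = 5 := Real.sq_sqrt (by norm_num)
  nlinarith [h5]

/-- `−0.30902 < cos 108° < −0.30901`. [cite: LiuEtAl2016RbEuFe4As4, p. 3 («109.04°»)] -/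
theorem cos_three_pi_div_five_bounds :
    -0.30902 < Real.cos (3 * Real.pi / 5) ∧ Real.cos (3 * Real.pi / 5) < -0.30901 := by
  rw [cos_three_pi_div_five]
  have h5lo : (2.23606 : ℝ) < Real.sqrt 5 := by rw [Real.lt_sqrt (by norm_num)]; norm_num
  have h5hi : Real.sqrt 5 < (2.23607 : ℝ) := by rw [Real.sqrt_lt' (by norm_num)]; norm_num
  constructor <;> linarith

/-- `5π/8` lies in `[0, π]`, so `arccos (cos ·)` returns it. [folklore] -/
private lemma arccos_cos_five_pi_div_eight : Real.arccos (Real.cos (5 * Real.pi / 8)) = 5 * Real.pi / 8 :=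
  Real.arccos_cos (by positivity) (by nlinarith [Real.pi_pos])

/-- `3π/5` lies in `[0, π]`. [folklore] -/
private lemma arccos_cos_three_pi_div_five : Real.arccos (Real.cos (3 * Real.pi / 5)) = 3 * Real.pi / 5 :=
  Real.arccos_cos (by positivity) (by nlinarith [Real.pi_pos])

/-- A twofold angle exceeds `112.5°` iff its cosine is below `cos(5π/8)`. [cite: Johnston2010, §2.1 Eqs. (Eqtheta)] -/
theorem five_pi_div_eight_lt_twofoldAngle_iff (a h : ℝ) (ha : a ≠ 0) :
    5 * Real.pi / 8 < twofoldAngle a h ↔ cosTwofold a h < Real.cos (5 * Real.pi / 8) := by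
  unfold twofoldAngle
  rw [← arccos_cos_five_pi_div_eight,
    Real.strictAntiOn_arccos.lt_iff_gt (Real.cos_mem_Icc _) (cosTwofold_mem_Icc a h ha),
    arccos_cos_five_pi_div_eight]

/-- A twofold angle is below `108°` iff its cosine is above `cos(3π/5)`. [cite: Johnston2010, §2.1 Eqs. (Eqtheta)] -/
theorem twofoldAngle_lt_three_pi_div_five_iff (a h : ℝ) (ha : a ≠ 0) :
    twofoldAngle a h < 3 * Real.pi / 5 ↔ Real.cos (3 * Real.pi / 5) < cosTwofold a h := by
  unfold twofoldAngle
  rw [← arccos_cos_three_pi_div_five,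
    Real.strictAntiOn_arccos.lt_iff_gt (cosTwofold_mem_Icc a h ha) (Real.cos_mem_Icc _),
    arccos_cos_three_pi_div_five]

/-- A mixed angle exceeds `108°` iff its cosine is below `cos(3π/5)`. [cite: LiuEtAl2016RbEuFe4As4, p. 3] -/
theorem three_pi_div_five_lt_mixedAngle_iff (a h₁ h₂ : ℝ) (ha : a ≠ 0) (hh₁ : 0 ≤ h₁) (hh₂ : 0 ≤ h₂) :
    3 * Real.pi / 5 < mixedAngle a h₁ h₂ ↔ cosMixed a h₁ h₂ < Real.cos (3 * Real.pi / 5) := by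
  have hm : cosMixed a h₁ h₂ ∈ Set.Icc (-1 : ℝ) 1 := by
    obtain ⟨h1, h2⟩ := cosMixed_mem_Ioc a h₁ h₂ ha hh₁ hh₂
    exact ⟨h1.le, by linarith⟩
  unfold mixedAngle
  rw [← arccos_cos_three_pi_div_five,
    Real.strictAntiOn_arccos.lt_iff_gt (Real.cos_mem_Icc _) hm, arccos_cos_three_pi_div_five]

/-! ### Witness 1: `RbEuFe₄As₄` (Liu et al. 2016, TABLE I; RT powder XRD, Rietveld)

`P4/mmm`, `a = 3.8897(1)`, `c = 13.3146(6) Å`; Fe `4i (0, ½, 0.2404(6))`; As1 `2g (0, 0, 0.3342(5))` (Rb side, above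
the Fe plane); As2 `2h (½, ½, 0.1300(5))` (Eu side, below). Heights (exact products of the printed decimals):
`h₁ = (0.3342 − 0.2404)·13.3146 = 1.24890948 Å` (printed «1.249»), `h₂ = (0.2404 − 0.1300)·13.3146 = 1.46993184 Å`
(printed «1.467»). -/

/-- `RbEuFe₄As₄`: the As1 height above the Fe plane is `height z_As1 z_Fe c = 1.24890948 Å` (printed 1.249).
[cite: LiuEtAl2016RbEuFe4As4, TABLE I and p. 3] -/
theorem rbEuFe4As4_height_As1 :
    height (3342 / 10000) (2404 / 10000) (133146 / 10000) = 124890948 / 100000000 := by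
  unfold height
  rw [abs_of_nonneg (by norm_num)]
  norm_num

/-- `RbEuFe₄As₄`: the As2 height below the Fe plane is `height z_As2 z_Fe c = 1.46993184 Å` (printed 1.467; the
difference 0.003 Å is 0.0002 in `z`, inside the e.s.d.). [cite: LiuEtAl2016RbEuFe4As4, TABLE I and p. 3] -/
theorem rbEuFe4As4_height_As2 :
    height (1300 / 10000) (2404 / 10000) (133146 / 10000) = 146993184 / 100000000 := by
  unfold height
  rw [abs_of_nonpos (by norm_num)]
  norm_num

/-- `RbEuFe₄As₄`, As1–Fe–As1: `−0.4161 < cos θ₂(h₁) < −0.4160` (`θ₂ = 114.59°`). [cite: LiuEtAl2016RbEuFe4As4, TABLE I] -/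
theorem rbEuFe4As4_cosTwofold_As1 :
    -0.4161 < cosTwofold (38897 / 10000) (124890948 / 100000000) ∧
      cosTwofold (38897 / 10000) (124890948 / 100000000) < -0.4160 := by
  unfold cosTwofold
  constructor
  · rw [lt_div_iff₀ (by norm_num)]; norm_num
  · rw [div_lt_iff₀ (by norm_num)]; norm_num

/-- `RbEuFe₄As₄`, As2–Fe–As2: `−0.2729 < cos θ₂(h₂) < −0.2728` (`θ₂ = 105.84°`). [cite: LiuEtAl2016RbEuFe4As4, TABLE I] -/
theorem rbEuFe4As4_cosTwofold_As2 :
    -0.2729 < cosTwofold (38897 / 10000) (146993184 / 100000000) ∧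
      cosTwofold (38897 / 10000) (146993184 / 100000000) < -0.2728 := by
  unfold cosTwofold
  constructor
  · rw [lt_div_iff₀ (by norm_num)]; norm_num
  · rw [div_lt_iff₀ (by norm_num)]; norm_num

/-- `RbEuFe₄As₄`, mixed As1–Fe–As2: `−0.3259 < cos θ_m < −0.3257` (`θ_m = 109.01°`; the printed «109.04°»).
[cite: LiuEtAl2016RbEuFe4As4, TABLE I and p. 3] -/
theorem rbEuFe4As4_cosMixed :
    -0.3259 < cosMixed (38897 / 10000) (124890948 / 100000000) (146993184 / 100000000) ∧
      cosMixed (38897 / 10000) (124890948 / 100000000) (146993184 / 100000000) < -0.3257 := by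
  have hd₁ : (0:ℝ) ≤ (38897 / 10000) ^ 2 / 4 + (124890948 / 100000000) ^ 2 := by positivity
  have hd₂ : (0:ℝ) ≤ (38897 / 10000) ^ 2 / 4 + (146993184 / 100000000) ^ 2 := by positivity
  have hprod : bondLength (38897 / 10000) (124890948 / 100000000) *
      bondLength (38897 / 10000) (146993184 / 100000000) =
      Real.sqrt (((38897 / 10000) ^ 2 / 4 + (124890948 / 100000000) ^ 2) *
        ((38897 / 10000) ^ 2 / 4 + (146993184 / 100000000) ^ 2)) := by
    unfold bondLength; rw [← Real.sqrt_mul hd₁]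
  have hQpos : (0:ℝ) < ((38897 / 10000) ^ 2 / 4 + (124890948 / 100000000) ^ 2) *
        ((38897 / 10000) ^ 2 / 4 + (146993184 / 100000000) ^ 2) := by positivity
  have hs := Real.sqrt_pos.mpr hQpos
  -- bounds on the square root of the product of the two squared bond lengths: 5.6346 < √Q < 5.6348
  have hslo : (5.6346 : ℝ) < Real.sqrt (((38897 / 10000) ^ 2 / 4 + (124890948 / 100000000) ^ 2) *
        ((38897 / 10000) ^ 2 / 4 + (146993184 / 100000000) ^ 2)) := by
    rw [Real.lt_sqrt (by norm_num)]; norm_num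
  have hshi : Real.sqrt (((38897 / 10000) ^ 2 / 4 + (124890948 / 100000000) ^ 2) *
        ((38897 / 10000) ^ 2 / 4 + (146993184 / 100000000) ^ 2)) < (5.6348 : ℝ) := by
    rw [Real.sqrt_lt' (by norm_num)]; norm_num
  unfold cosMixed
  rw [hprod]
  constructor
  · rw [lt_div_iff₀ hs]; nlinarith
  · rw [div_lt_iff₀ hs]; nlinarith

/-- `RbEuFe₄As₄`: the Rb-side half-tetrahedron is FLATTENED — `h₁² < a²/8`, so `θ₂(As1) > arccos(−1/3)`.
[cite: LiuEtAl2016RbEuFe4As4, TABLE I]; [cite: Johnston2010, §2.1] -/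
theorem rbEuFe4As4_As1_twofold_gt_tetrahedral :
    tetrahedralAngle < twofoldAngle (38897 / 10000) (124890948 / 100000000) := by
  rw [tetrahedralAngle_lt_twofoldAngle_iff_sq_lt _ _ (by norm_num)]
  norm_num

/-- `RbEuFe₄As₄`: the Eu-side half-tetrahedron is TALL — `h₂² > a²/8`, so `θ₂(As2) < arccos(−1/3)` (the regular
height `a/(2√2) = 1.375 Å` lies between `h₁` and `h₂`). [cite: LiuEtAl2016RbEuFe4As4, TABLE I]; [cite: Johnston2010, §2.1] -/
theorem rbEuFe4As4_As2_twofold_lt_tetrahedral :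
    twofoldAngle (38897 / 10000) (146993184 / 100000000) < tetrahedralAngle := by
  rw [twofoldAngle_lt_tetrahedralAngle_iff_lt_sq _ _ (by norm_num)]
  norm_num

/-- **`RbEuFe₄As₄`: the TABLE-I As1–Fe–As1 angle is strictly larger than the printed «112.50°»** (`= 5π/8`):
`cos θ₂(h₁) < −0.4160 < −0.3827 < cos(5π/8)`. [cite: LiuEtAl2016RbEuFe4As4, TABLE I vs p. 3 («112.50°»)] -/
theorem rbEuFe4As4_As1_twofold_gt_printed :
    5 * Real.pi / 8 < twofoldAngle (38897 / 10000) (124890948 / 100000000) := by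
  rw [five_pi_div_eight_lt_twofoldAngle_iff _ _ (by norm_num)]
  linarith [rbEuFe4As4_cosTwofold_As1.2, cos_five_pi_div_eight_bounds.1]

/-- **`RbEuFe₄As₄`: the TABLE-I As2–Fe–As2 angle is strictly below `108°`** (`= 3π/5`), hence below the printed
«109.04°»: `cos(3π/5) < −0.30901 < −0.2729 < cos θ₂(h₂)`. [cite: LiuEtAl2016RbEuFe4As4, TABLE I vs p. 3 («109.04°»)] -/
theorem rbEuFe4As4_As2_twofold_lt_printed :
    twofoldAngle (38897 / 10000) (146993184 / 100000000) < 3 * Real.pi / 5 := by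
  rw [twofoldAngle_lt_three_pi_div_five_iff _ _ (by norm_num)]
  linarith [rbEuFe4As4_cosTwofold_As2.1, cos_three_pi_div_five_bounds.2]

/-- **`RbEuFe₄As₄`: it is the MIXED As1–Fe–As2 angle that lies in `(108°, arccos(−1/3))`** (`109.01°`) — the
window containing the printed «109.04°». [cite: LiuEtAl2016RbEuFe4As4, TABLE I vs p. 3] -/
theorem rbEuFe4As4_mixedAngle_window :
    3 * Real.pi / 5 < mixedAngle (38897 / 10000) (124890948 / 100000000) (146993184 / 100000000) ∧
      mixedAngle (38897 / 10000) (124890948 / 100000000) (146993184 / 100000000) < tetrahedralAngle := by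
  constructor
  · rw [three_pi_div_five_lt_mixedAngle_iff _ _ _ (by norm_num) (by norm_num) (by norm_num)]
    linarith [rbEuFe4As4_cosMixed.2, cos_three_pi_div_five_bounds.1]
  · rw [mixedAngle_lt_tetrahedralAngle_iff _ _ _ (by norm_num) (by norm_num) (by norm_num)]
    linarith [rbEuFe4As4_cosMixed.1]

/-- `RbEuFe₄As₄`: the six-angle cosine sum is `> −2` strictly — the tetrahedron is genuinely asymmetric
(`−1.9922`, excess `2(h₁/r₁ − h₂/r₂)² ≈ 0.0078`). [cite: LiuEtAl2016RbEuFe4As4, TABLE I] -/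
theorem rbEuFe4As4_angleSum_gt :
    -2 < cosTwofold (38897 / 10000) (124890948 / 100000000) +
      cosTwofold (38897 / 10000) (146993184 / 100000000) +
      4 * cosMixed (38897 / 10000) (124890948 / 100000000) (146993184 / 100000000) := by
  linarith [rbEuFe4As4_cosTwofold_As1.1, rbEuFe4As4_cosTwofold_As2.1, rbEuFe4As4_cosMixed.1]

/-! ### Witness 2: `CaKFe₄As₄` (Mou et al. 2016, TABLE I; single-crystal XRD)

`P4/mmm`, `a = 3.8659(12)`, `c = 12.884(5) Å`; Fe `4i (0, ½, 0.7682(2))` (≡ `z = 0.2318` by the mirror); As1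
`2g (0, 0, 0.3415(2))` (K side); As2 `2h (½, ½, 0.1231(2))` (Ca side). Heights `h₁ = (0.3415 − 0.2318)·12.884 =
1.4133748 Å`, `h₂ = (0.2318 − 0.1231)·12.884 = 1.4004908 Å`: BOTH above the regular height `a/(2√2) = 1.367 Å`,
both twofold angles `< arccos(−1/3)` (107.65°, 108.15°) and the mixed angle `> arccos(−1/3)` (110.26°) — the
opposite placement to `RbEuFe₄As₄`'s Rb side («the As relative heights as well as the bond angles are opposite to
the result in RbCaFe₄As₄», Liu et al.). -/

/-- `CaKFe₄As₄` heights from TABLE I: `h₁ = 1.4133748`, `h₂ = 1.4004908 Å`. [cite: MouEtAl2016CaKFe4As4, TABLE I] -/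
theorem caKFe4As4_heights :
    height (3415 / 10000) (2318 / 10000) (12884 / 1000) = 14133748 / 10000000 ∧
      height (1231 / 10000) (2318 / 10000) (12884 / 1000) = 14004908 / 10000000 := by
  unfold height
  rw [abs_of_nonneg (by norm_num), abs_of_nonpos (by norm_num)]
  constructor <;> norm_num

/-- `CaKFe₄As₄`: both half-tetrahedra are tall — `θ₂(As1) < arccos(−1/3)` and `θ₂(As2) < arccos(−1/3)`.
[cite: MouEtAl2016CaKFe4As4, TABLE I]; [cite: Johnston2010, §2.1] -/
theorem caKFe4As4_twofold_lt_tetrahedral :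
    twofoldAngle (38659 / 10000) (14133748 / 10000000) < tetrahedralAngle ∧
      twofoldAngle (38659 / 10000) (14004908 / 10000000) < tetrahedralAngle := by
  constructor
  · rw [twofoldAngle_lt_tetrahedralAngle_iff_lt_sq _ _ (by norm_num)]; norm_num
  · rw [twofoldAngle_lt_tetrahedralAngle_iff_lt_sq _ _ (by norm_num)]; norm_num

/-- `CaKFe₄As₄`, mixed As1–Fe–As2: `−0.3464 < cos θ_m < −0.3462` (`θ_m = 110.26°`). [cite: MouEtAl2016CaKFe4As4, TABLE I] -/
theorem caKFe4As4_cosMixed :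
    -0.3464 < cosMixed (38659 / 10000) (14133748 / 10000000) (14004908 / 10000000) ∧
      cosMixed (38659 / 10000) (14133748 / 10000000) (14004908 / 10000000) < -0.3462 := by
  have hd₁ : (0:ℝ) ≤ (38659 / 10000) ^ 2 / 4 + (14133748 / 10000000) ^ 2 := by positivity
  have hprod : bondLength (38659 / 10000) (14133748 / 10000000) *
      bondLength (38659 / 10000) (14004908 / 10000000) =
      Real.sqrt (((38659 / 10000) ^ 2 / 4 + (14133748 / 10000000) ^ 2) *
        ((38659 / 10000) ^ 2 / 4 + (14004908 / 10000000) ^ 2)) := by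
    unfold bondLength; rw [← Real.sqrt_mul hd₁]
  have hQpos : (0:ℝ) < ((38659 / 10000) ^ 2 / 4 + (14133748 / 10000000) ^ 2) *
        ((38659 / 10000) ^ 2 / 4 + (14004908 / 10000000) ^ 2) := by positivity
  have hs := Real.sqrt_pos.mpr hQpos
  -- 5.7157 < √Q < 5.7159 (r₁ r₂ = 2.3946 · 2.3870 = 5.71577)
  have hslo : (5.7157 : ℝ) < Real.sqrt (((38659 / 10000) ^ 2 / 4 + (14133748 / 10000000) ^ 2) *
        ((38659 / 10000) ^ 2 / 4 + (14004908 / 10000000) ^ 2)) := by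
    rw [Real.lt_sqrt (by norm_num)]; norm_num
  have hshi : Real.sqrt (((38659 / 10000) ^ 2 / 4 + (14133748 / 10000000) ^ 2) *
        ((38659 / 10000) ^ 2 / 4 + (14004908 / 10000000) ^ 2)) < (5.7159 : ℝ) := by
    rw [Real.sqrt_lt' (by norm_num)]; norm_num
  unfold cosMixed
  rw [hprod]
  constructor
  · rw [lt_div_iff₀ hs]; nlinarith
  · rw [div_lt_iff₀ hs]; nlinarith

/-- `CaKFe₄As₄`: the mixed angle EXCEEDS the regular-tetrahedron angle (`cos θ_m < −1/3`), opposite to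
`RbEuFe₄As₄`. [cite: MouEtAl2016CaKFe4As4, TABLE I]; [cite: LiuEtAl2016RbEuFe4As4, p. 3 («opposite to the result
in RbCaFe₄As₄»)] -/
theorem caKFe4As4_mixedAngle_gt_tetrahedral :
    tetrahedralAngle < mixedAngle (38659 / 10000) (14133748 / 10000000) (14004908 / 10000000) := by
  rw [tetrahedralAngle_lt_mixedAngle_iff _ _ _ (by norm_num) (by norm_num) (by norm_num)]
  linarith [caKFe4As4_cosMixed.2]

/-! ## §9 The Fehrenbacher–Rice band factor `cos 2φ` of the `R–O₈` cage of `RBa₂Cu₃O₇` (appended 2026-08-27, lit-4 g14)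

The same two-atom geometry in another structure: the rare-earth site of `RBa₂Cu₃O₇` sits between two `CuO₂` planes,
with the plane oxygens O(2)/O(3) at horizontal distance `a/2` (resp. `b/2`) and height `v` above/below it — exactly the
«twofold pair» of §1 with `(a, h) ↦ (a, v)`. Mazin's nearest-neighbour tight-binding treatment of the Fehrenbacher–Rice
`Pr 4f_{z(x²−y²)}`–`O 2pπ` state gives the band `ε_k − E_p = δε − δε cos 2φ (cos ak_x + cos bk_y)/2`, bandwidth
`W = δε cos 2φ`, where `φ` is the angle the `R–O` bond makes with the plane; «Had this angle been 45°, as assumed by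
FR, the band would be dispersionless»; for the ideal geometry `φ = arctan(1/√2)`, `W = δε/3`. -/

/-- THE FR DISPERSION FACTOR `cos 2φ = ((a/2)² − v²)/((a/2)² + v²)` for an `R–O` bond of horizontal run `a/2` and rise
`v` (`tan φ = 2v/a`). [cite: Mazin1999PrBa2Cu3O7FRband, p. 4 (tight-binding band `ε_k − E_p = δε − δε cos 2φ (cos ak_x + cos bk_y)/2`, `W = δε cos 2φ`)] -/
def frFactor (a v : ℝ) : ℝ := (a ^ 2 / 4 - v ^ 2) / (a ^ 2 / 4 + v ^ 2)

/-- It is minus the cosine of the twofold `O–R–O` angle of §1: `cos 2φ = −cos θ₂` (`2φ + θ₂ = π`).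
[cite: Mazin1999PrBa2Cu3O7FRband, p. 4] -/
theorem frFactor_eq_neg_cosTwofold (a v : ℝ) : frFactor a v = -cosTwofold a v := by
  unfold frFactor cosTwofold; ring

/-- `cos 2φ` as a function of the bond angle: `cos (2 arctan (2v/a)) = frFactor a v` (`a ≠ 0`).
[cite: Mazin1999PrBa2Cu3O7FRband, p. 4 («φ … is the angle that the Pr-O bond forms with the xy plane»)] -/
theorem cos_two_mul_arctan_eq_frFactor (a v : ℝ) (ha : a ≠ 0) :
    Real.cos (2 * Real.arctan (2 * v / a)) = frFactor a v := by
  rw [Real.cos_two_mul, Real.cos_arctan]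
  have h1 : 0 < 1 + (2 * v / a) ^ 2 := by positivity
  rw [div_pow, one_pow, Real.sq_sqrt h1.le]
  unfold frFactor
  have hd : a ^ 2 / 4 + v ^ 2 ≠ 0 := (denom_pos v ha).ne'
  rw [div_pow, eq_div_iff hd]
  field_simp
  ring

/-- FR's `45°` cage (`v = a/2`) is dispersionless: `cos 2φ = 0`. [cite: Mazin1999PrBa2Cu3O7FRband, p. 4 («Had this angle
been 45° … the band would be dispersionless»)] -/
theorem frFactor_fortyfive (a : ℝ) : frFactor a (a / 2) = 0 := by
  unfold frFactor
  have : a ^ 2 / 4 - (a / 2) ^ 2 = 0 := by ring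
  rw [this, zero_div]

/-- Mazin's ideal cage `tan φ = 1/√2`, i.e. `v² = a²/8`: `cos 2φ = 1/3` («W = δε cos 2φ = δε/3») — and this is exactly the
REGULAR-TETRAHEDRON condition `cos θ₂ = −1/3` of §1 (`cosTwofold_eq_neg_third_iff`).
[cite: Mazin1999PrBa2Cu3O7FRband, p. 4 («φ = arctan(1/√2) … W = δε cos 2φ = δε/3»)] -/
theorem frFactor_eq_third_iff (a v : ℝ) (ha : a ≠ 0) : frFactor a v = 1 / 3 ↔ v ^ 2 = a ^ 2 / 8 := by
  rw [← cosTwofold_eq_neg_third_iff a v ha, frFactor_eq_neg_cosTwofold]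
  constructor <;> intro H <;> linarith

/-- … in particular `tan φ = 2v/a = 1/√2` gives `cos 2φ = 1/3`. [cite: Mazin1999PrBa2Cu3O7FRband, p. 4] -/
theorem frFactor_ideal (a : ℝ) (ha : a ≠ 0) : frFactor a (a / (2 * Real.sqrt 2)) = 1 / 3 := by
  rw [frFactor_eq_third_iff a _ ha, div_pow, mul_pow, Real.sq_sqrt (by norm_num : (0:ℝ) ≤ 2)]
  ring

/-! ### Witness: the refined `PrBa₂Cu₃O₇` cage (Pmmm, `a = 3.8654`, `b = 3.9309`, `c = 11.725 Å`; Pr at `z = 1/2`,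
O(3) at `(0, 1/2, 0.3726)`, O(4) at `(1/2, 0, 0.3739)`) -/

/-- Rise of the Pr–O(3) bond: `v₃ = (1/2 − 0.3726)·c`, `1.493 < v₃ < 1.494 Å`; Pr–O(4): `v₄ = (1/2 − 0.3739)·c`,
`1.478 < v₄ < 1.479 Å`. [cite: LopezMoralesEtAl1990PrBa2Cu3O7, refined structure (COD 1534701: a 3.8654, b 3.9309, c 11.725; z(O3) 0.3726, z(O4) 0.3739, Pr z = 1/2)] -/
theorem prBa2Cu3O7_rise :
    ((1.493 : ℝ) < (1 / 2 - 0.3726) * 11.725 ∧ (1 / 2 - 0.3726) * 11.725 < (1.494 : ℝ)) ∧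
      ((1.478 : ℝ) < (1 / 2 - 0.3739) * 11.725 ∧ (1 / 2 - 0.3739) * 11.725 < (1.479 : ℝ)) := by
  refine ⟨⟨by norm_num, by norm_num⟩, ⟨by norm_num, by norm_num⟩⟩

/-- The real cage is STEEPER than Mazin's ideal: `tan² φ = (2v/a)² > 1/2` for both bonds (`0.597` along `a`, `0.565`
along `b`), i.e. `φ(O3) ≈ 37.7°`, `φ(O4) ≈ 37.0°` vs `35.3°`. [cite: LopezMoralesEtAl1990PrBa2Cu3O7, refined structure (COD 1534701)]
[cite: Mazin1999PrBa2Cu3O7FRband, p. 4] -/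
theorem prBa2Cu3O7_steeper_than_ideal :
    (1 : ℝ) / 2 < (2 * ((1 / 2 - 0.3726) * 11.725) / 3.8654) ^ 2 ∧
      (1 : ℝ) / 2 < (2 * ((1 / 2 - 0.3739) * 11.725) / 3.9309) ^ 2 := by
  constructor <;> norm_num

/-- Hence the FR band factor of the refined cage is BELOW Mazin's ideal `1/3`: **`0.25 < cos 2φ(O3) < 0.26`** (along `a`)
and **`0.27 < cos 2φ(O4) < 0.28`** (along `b`) — the located bandwidth `W/δε` is `0.25–0.28`, not `0.33`.
[cite: Mazin1999PrBa2Cu3O7FRband, p. 4 («W = δε cos 2φ = δε/3»)] [cite: LopezMoralesEtAl1990PrBa2Cu3O7, refined structure (COD 1534701)] -/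
theorem prBa2Cu3O7_frFactor :
    (0.25 < frFactor 3.8654 ((1 / 2 - 0.3726) * 11.725) ∧ frFactor 3.8654 ((1 / 2 - 0.3726) * 11.725) < 0.26) ∧
      (0.27 < frFactor 3.9309 ((1 / 2 - 0.3739) * 11.725) ∧ frFactor 3.9309 ((1 / 2 - 0.3739) * 11.725) < 0.28) ∧
        frFactor 3.8654 ((1 / 2 - 0.3726) * 11.725) < 1 / 3 ∧ frFactor 3.9309 ((1 / 2 - 0.3739) * 11.725) < 1 / 3 := by
  unfold frFactor
  refine ⟨⟨?_, ?_⟩, ⟨?_, ?_⟩, ?_, ?_⟩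
  · rw [lt_div_iff₀ (by norm_num)]; norm_num
  · rw [div_lt_iff₀ (by norm_num)]; norm_num
  · rw [lt_div_iff₀ (by norm_num)]; norm_num
  · rw [div_lt_iff₀ (by norm_num)]; norm_num
  · rw [div_lt_iff₀ (by norm_num)]; norm_num
  · rw [div_lt_iff₀ (by norm_num)]; norm_num

end MX4

end Literature.MathematicalPhysics.QuantumManyBody

end
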